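import Literature.NumberTheory.EllipticCurves.WeilPairingProofs
import Literature.NumberTheory.EllipticCurves.IsogenyRamification
import Literature.NumberTheory.EllipticCurves.WeilPairingAdjoint
import HarnessLib

/-!
# The Weil pairing is adjoint for an isogeny and `[deg φ]`: Prop. III.8.2 (dual-free), and the discharge of `exists_weilPairing_adjoint`

Topic `NumberTheory/EllipticCurves` (trunk T-ELLARITH); the `…Proofs` sibling of
`Literature.NumberTheory.EllipticCurves.WeilPairingAdjoint`, whose named fact
`WeierstrassCurve.exists_weilPairing_adjoint W m` — Silverman, *AEC*, 2nd ed., Prop. III.8.1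
(a)–(d) together with Prop. III.8.2 in the dual-free form `e_m(φ S, φ P) = e_m(S, [deg φ] P)`
(Thm. III.6.1(b)), for one and the same pairing `e_m` — is **discharged** here
(`exists_weilPairing_adjoint_holds`). It is the input of `Isogeny.det_tateModule_map_eq_deg_of_facts`
(`FrobeniusEndomorphismDetDegProofs`), i.e. of Prop. III.8.6, `det(φ_ℓ) = deg φ`.

The pairing is the tree's Weil pairing `weilPairingFun hm S T = τ_S^* h_T / h_T` of
`WeilPairingProofs` (`h_T` a *Weil function* for `T`: `div(h_T) = [m]^*(T) - [m]^*(O)`), for which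
that file proves Prop. III.8.1 (a)–(d) (`weilPairingFun_pow`, `weilPairingFun_add_left`,
`weilPairingFun_add_right`, `weilPairingFun_self`, `eq_zero_of_weilPairingFun_eq_one`,
`weilPairingFun_smul`) and the tree's `exists_weilPairing`. New here is

* **`weilPairingFun_isogeny` — Prop. III.8.2 with Thm. III.6.1(b), dual-free**: for an isogeny
  `φ : E → E` over `K`, `S ∈ E[m]` and `P` with `φ P ∈ E[m]`,
  `e_m(φ S, φ P) = e_m(S, [deg φ] P)`. This is Silverman's proof of `e_m(φ S, T) = e_m(S, φ̂ T)`
  (PDF pp. 90–91) for `T = φ P`, with the dual `φ̂ T` replaced by its value `Q̂ = [deg φ] P`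
  (Thm. III.6.1(b): "`φ̂(Q) = [deg φ](P)` for any `P ∈ φ⁻¹(Q)`"): choose `h ∈ K̄(E)` with
  `div(h) = φ^*((T)) - φ^*((O)) - (Q̂) + (O)`. Here `φ^*((Q)) = e_φ Σ_{φ R = Q} (R)` with the
  constant ramification index `e_φ` of `IsogenyRamification`, and the divisor has degree `0` and
  sum `e_φ [#ker φ] P - Q̂ = O` **because `e_φ · #ker φ = deg φ`** (`Isogeny.ramIdx_mul_card_ker`,
  the ramification half of Thm. III.4.10(a)) — this replaces Silverman's appeal to the dual isogeny
  and works for inseparable `φ` as well. Then `h_T ∘ φ` and `(h ∘ [m]) · h_{Q̂}` have the same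
  divisor (`ord_R(u ∘ φ) = e_φ ord_{φR}(u)`, `Isogeny.ordAt_pullbackHom_eq`; `ord_R(u ∘ [m]) =
  ord_{mR}(u)`, `[m]` being unramified, `Isogeny.ordAt_pullbackHom_zsmul`), so they are
  proportional (Cor. III.3.5 / Prop. II.1.2, the tree's `exists_ord_eq`, `exists_eq_smul_of_ord_eq`
  of `WeilPairingDivisors`); applying `τ_S^*` and using `τ_S^* ∘ φ^* = φ^* ∘ τ_{φ S}^*`
  (`Isogeny.transAlgHom_pullbackHom`) and `τ_S^* ∘ [m]^* = [m]^* ∘ τ_{mS}^* = [m]^*` (`m S = O`)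
  gives `e_m(φ S, T) · (h_T ∘ φ) = e_m(S, Q̂) · (h_T ∘ φ)`.
* `exists_weilPairing_adjoint_holds` — the discharge, assembling the above.

Auxiliary: `indicatorDiv s = Σ_{P ∈ s} (P)` (for the bookkeeping of `div(h)`; degree and sum of a
divisor are Mathlib's `Finsupp.degree` and `Finsupp.weight id`), `IsWeilFunction.ordAt_eq` (the
divisor of a Weil function fibrewise: `ord_R(h_T) = [mR = T] - [mR = O]`),
`deg_nsmul_eq_zero_of_mem_ker` (`[deg φ] R = O` on `ker φ`, from `#ker φ ∣ deg φ`).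

## References

* [SilvermanAEC2009] J. H. Silverman, *The Arithmetic of Elliptic Curves*, 2nd ed., GTM 106,
  Springer 2009: Prop. III.8.2 with its proof (PDF pp. 90–91), Thm. III.6.1(b) (PDF pp. 78–79),
  Thm. III.4.10(a), Cor. III.3.5, III.§8 (construction of `e_m`, PDF p. 88).

## Design

`noncomputable section`, `open scoped Classical`, one universe `u`, `namespace WeierstrassCurve`, as
the siblings; the level `m : ℕ` is implicit and `hm : (m : K) ≠ 0` explicit, as in
`WeilPairingProofs`.
-/

noncomputable section

open scoped Classical

universe u

namespace WeierstrassCurve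

open Literature.NumberTheory.EllipticCurves.WeierstrassFunctionField

variable {K : Type u} [Field K] {W : WeierstrassCurve K}

/-! ## Indicator divisors (degree and sum via Mathlib's `Finsupp.degree` / `Finsupp.weight id`) -/

section IndicatorDiv

/-- The indicator divisor `Σ_{P ∈ s} (P)` of a finite set of points (a local abbreviation for the
bookkeeping of `div(h)` below; the degree `deg D = Σ D(P)` and the sum `Σ [D(P)] P ∈ E(K̄)` of a
divisor `D : E(K̄) →₀ ℤ` (Silverman, *AEC*, II.§3, III.§3) are Mathlib's `Finsupp.degree D` and
`Finsupp.weight id D`). [folklore] -/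
def indicatorDiv (s : Finset W.geomPoints) : W.geomPoints →₀ ℤ :=
  ∑ P ∈ s, Finsupp.single P 1

/-- The multiplicity of `P` in `Σ_{Q ∈ s} (Q)`. [folklore] -/
theorem indicatorDiv_apply (s : Finset W.geomPoints) (P : W.geomPoints) :
    indicatorDiv s P = if P ∈ s then 1 else 0 := by
  rw [indicatorDiv, Finsupp.finsetSum_apply]
  simp only [Finsupp.single_apply]
  rw [Finset.sum_ite_eq']

/-- `deg Σ_{P ∈ s} (P) = #s`. [folklore] -/
@[simp] theorem degree_indicatorDiv (s : Finset W.geomPoints) :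
    Finsupp.degree (indicatorDiv s) = s.card := by
  rw [indicatorDiv, map_sum]
  simp

/-- `sum Σ_{P ∈ s} (P) = Σ_{P ∈ s} P` in `E(K̄)`. [folklore] -/
@[simp] theorem weight_id_indicatorDiv (s : Finset W.geomPoints) :
    Finsupp.weight _root_.id (indicatorDiv s) = ∑ P ∈ s, P := by
  rw [indicatorDiv, map_sum]
  simp [Finsupp.weight_single]

end IndicatorDiv

/-! ## The adjoint property of the Weil pairing (Prop. III.8.2, dual-free) -/

section Adjoint

variable [W.IsElliptic] {m : ℕ} (hm : (m : K) ≠ 0)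

omit [W.IsElliptic] in
/-- `m ≠ 0` in `ℤ` when `m ≠ 0` in `K`. [folklore] -/
theorem intCast_ne_zero_of_cast_ne_zero (hm : (m : K) ≠ 0) : (m : ℤ) ≠ 0 := by
  rintro h
  exact hm (by rw [Int.natCast_eq_zero.mp h, Nat.cast_zero])

/-- **The divisor of a Weil function, fibrewise**: `ord_R(h) = [mR = T] - [mR = O]` for a Weil
function `h` of `T` (`div h = [m]^*(T) - [m]^*(O)`, Silverman, *AEC*, III.§8).
[cite: SilvermanAEC2009, III.§8 (construction of e_m)] -/
theorem IsWeilFunction.ordAt_eq {T : W.geomPoints} {h : W.geomFunctionField}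
    (hh : IsWeilFunction W m T h) (R : W.geomPoints) :
    W.ordAt R h = (if (m : ℤ) • R = T then 1 else 0) - (if (m : ℤ) • R = 0 then 1 else 0) := by
  obtain ⟨-, T', hT', hord⟩ := hh
  change ord _ R h = _
  rw [hord R, torsionInd, torsionInd, smul_sub, hT', sub_eq_zero]

omit [W.IsElliptic] in
/-- A `K̄`-algebra map of function fields does not kill non-zero elements. [folklore] -/
theorem algHom_ne_zero {W' : WeierstrassCurve K}
    (f : W'.geomFunctionField →ₐ[AlgebraicClosure K] W.geomFunctionField)
    {u : W'.geomFunctionField} (hu : u ≠ 0) : f u ≠ 0 :=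
  (map_ne_zero_iff f f.toRingHom.injective).mpr hu

omit [W.IsElliptic] in
/-- In a finite additive group (here `ker φ`), `#ker φ • R = O`. [folklore] -/
theorem card_ker_nsmul_eq_zero (φ : Isogeny W W) {R : W.geomPoints} (hR : φ R = 0) :
    Nat.card φ.toAddMonoidHom.ker • R = 0 := by
  have hR' : R ∈ φ.toAddMonoidHom.ker := by rwa [AddMonoidHom.mem_ker, Isogeny.coe_toAddMonoidHom]
  have h := addOrderOf_dvd_natCard (⟨R, hR'⟩ : φ.toAddMonoidHom.ker)
  rw [addOrderOf_dvd_iff_nsmul_eq_zero] at h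
  exact congrArg Subtype.val h

/-- `deg φ • R = O` for `R ∈ ker φ` (`#ker φ ∣ deg φ`, the tree's `card_ker_dvd_deg_holds`).
[folklore] -/
theorem deg_nsmul_eq_zero_of_mem_ker (φ : Isogeny W W) {R : W.geomPoints} (hR : φ R = 0) :
    φ.deg • R = 0 := by
  obtain ⟨k, hk⟩ := φ.card_ker_dvd_deg_holds
  rw [hk, mul_nsmul']
  exact card_ker_nsmul_eq_zero φ (R := k • R) (by rw [map_nsmul, hR, nsmul_zero])

include hm in
/-- **Prop. III.8.2 (with Thm. III.6.1(b)), dual-free form: `e_m(φ S, φ P) = e_m(S, [deg φ] P)`**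
for the Weil pairing `e_m = weilPairingFun` of `WeilPairingProofs`, an isogeny `φ : E → E` over
`K`, `S ∈ E[m]` and `P` with `φ P ∈ E[m]`. Silverman's proof (PDF pp. 90–91) of
`e_m(φ S, T) = e_m(S, φ̂ T)`, for `T = φ P`, with the dual `φ̂ T` replaced by its value
`Q̂ = [deg φ] P` (Thm. III.6.1(b): "`φ̂(Q) = [deg φ] P` for any `P ∈ φ⁻¹(Q)`"): choose `h` with
`div(h) = φ^*((T)) - φ^*((O)) - (Q̂) + (O)`; this divisor is `e_φ 𝟙_{φ⁻¹T} - e_φ 𝟙_{ker φ} - (Q̂)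
+ (O)`, of degree `0` and sum `e_φ [#ker φ] P - Q̂ = [deg φ] P - Q̂ = O` since the fibre is
`P + ker φ` and **`e_φ · #ker φ = deg φ`** (`Isogeny.ramIdx_mul_card_ker`). Then `g_T ∘ φ` and
`(h ∘ [m]) · g_{Q̂}` have the same divisor (`ord_R(g_T ∘ φ) = e_φ ord_{φR}(g_T)`,
`ord_R(h ∘ [m]) = ord_{mR}(h)`), so `g_T ∘ φ = κ · (h ∘ [m]) · g_{Q̂}`; applying `τ_S^*` with
`τ_S^* ∘ φ^* = φ^* ∘ τ_{φS}^*` and `τ_S^* ∘ [m]^* = [m]^* ∘ τ_{mS}^* = [m]^*` (`m S = O`) gives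
`e_m(φ S, T) · (g_T ∘ φ) = e_m(S, Q̂) · (g_T ∘ φ)`. No dual isogeny and no separability of `φ`
is used. [cite: SilvermanAEC2009, Prop. III.8.2 with Thm. III.6.1(b)] -/
theorem weilPairingFun_isogeny (φ : Isogeny W W) {S : W.geomPoints} (hS : (m : ℤ) • S = 0)
    {P : W.geomPoints} (hP : (m : ℤ) • φ P = 0) :
    weilPairingFun hm (φ S) (φ P) = weilPairingFun hm S (φ.deg • P) := by
  have hmZ : (m : ℤ) ≠ 0 := intCast_ne_zero_of_cast_ne_zero hm
  have hmK : ((m : ℤ) : K) ≠ 0 := by rwa [Int.cast_natCast]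
  set T := φ P with hTdef
  set Qh := φ.deg • P with hQh
  have hφS : (m : ℤ) • φ S = 0 := by rw [← map_zsmul, hS, map_zero]
  have hmP : φ ((m : ℤ) • P) = 0 := by rw [map_zsmul]; exact hP
  have hQh0 : (m : ℤ) • Qh = 0 := by
    rw [hQh, smul_comm]
    exact deg_nsmul_eq_zero_of_mem_ker φ hmP
  -- the Weil functions of `T` and of `Qh`
  have hgT := isWeilFunction_weilFn hm hP
  have hgQ := isWeilFunction_weilFn hm hQh0
  set gT := weilFn hm hP with hgTdef
  set gQ := weilFn hm hQh0 with hgQdef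
  -- the fibre and the kernel as finite sets
  set fib := (φ.finite_fibre T).toFinset with hfib
  set ker := φ.finite_ker.toFinset with hker
  have hmemfib : ∀ R, R ∈ fib ↔ φ R = T := fun R ↦ by rw [hfib, Set.Finite.mem_toFinset, Set.mem_setOf_eq]
  have hmemker : ∀ R, R ∈ ker ↔ φ R = 0 := fun R ↦ by
    rw [hker, Set.Finite.mem_toFinset, SetLike.mem_coe, AddMonoidHom.mem_ker, Isogeny.coe_toAddMonoidHom]
  have hfibim : fib = ker.image fun R ↦ P + R := by rw [hfib, hTdef, φ.toFinset_fibre_eq_image P]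
  have hcardfib : fib.card = ker.card := by rw [hfibim, Finset.card_image_of_injective _ (add_right_injective P)]
  have hcardker : ker.card = Nat.card φ.toAddMonoidHom.ker := by
    change _ = Nat.card (φ.toAddMonoidHom.ker : Set W.geomPoints)
    rw [Nat.card_coe_set_eq, Set.ncard_eq_toFinset_card _ φ.finite_ker]
  -- the divisor of `h`
  set e : ℤ := (φ.ramIdx : ℤ) with he
  set Dh : W.geomPoints →₀ ℤ := e • indicatorDiv fib - e • indicatorDiv ker - Finsupp.single Qh 1 +
    Finsupp.single 0 1 with hDh
  have hDhdeg : Finsupp.degree Dh = 0 := by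
    rw [hDh, map_add, map_sub, map_sub, map_zsmul, map_zsmul, degree_indicatorDiv, degree_indicatorDiv,
      Finsupp.degree_single, Finsupp.degree_single, hcardfib]
    ring
  have hDhsum : Finsupp.weight _root_.id Dh = 0 := by
    rw [hDh, map_add, map_sub, map_sub, map_zsmul, map_zsmul, weight_id_indicatorDiv,
      weight_id_indicatorDiv, Finsupp.weight_single, Finsupp.weight_single, id_eq, id_eq, hfibim,
      Finset.sum_image fun R _ R' _ h ↦ add_left_cancel h,
      Finset.sum_add_distrib, Finset.sum_const, smul_add, add_sub_cancel_right, one_smul, smul_zero,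
      add_zero, hcardker, he, ← natCast_zsmul, ← mul_smul, hQh]
    have : (φ.ramIdx : ℤ) * (Nat.card φ.toAddMonoidHom.ker : ℕ) = (φ.deg : ℕ) := by
      rw [← φ.ramIdx_mul_card_ker]; push_cast; ring
    rw [this, natCast_zsmul, sub_self]
  obtain ⟨h, hh0, hordh⟩ := exists_ord_eq Dh hDhdeg
    (by simpa only [Finsupp.weight_apply, id_eq] using hDhsum)
  replace hordh : ∀ P, W.ordAt P h = Dh P := hordh
  have hordh' : ∀ R, W.ordAt R h = e * (if φ R = T then 1 else 0) - e * (if φ R = 0 then 1 else 0) -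
      (if Qh = R then 1 else 0) + (if (0 : W.geomPoints) = R then 1 else 0) := fun R ↦ by
    rw [hordh R, hDh]
    simp only [Finsupp.coe_add, Finsupp.coe_sub, Finsupp.coe_smul, Pi.add_apply, Pi.sub_apply,
      Pi.smul_apply, Finsupp.single_apply, indicatorDiv_apply, hmemfib, hmemker, smul_eq_mul]
  -- `g_T ∘ φ` and `(h ∘ [m]) g_{Qh}` have the same divisor
  set hm' := (Isogeny.zsmul W m hmZ).pullbackHom h with hhm'
  have hhm'0 : hm' ≠ 0 := algHom_ne_zero _ hh0
  set u := hm' * gQ with hu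
  have hu0 : u ≠ 0 := mul_ne_zero hhm'0 hgQ.1
  have hφg0 : φ.pullbackHom gT ≠ 0 := algHom_ne_zero _ hgT.1
  have hord : ∀ R, W.ordAt R (φ.pullbackHom gT) = W.ordAt R u := by
    intro R
    rw [φ.ordAt_pullbackHom_eq, hgT.ordAt_eq, hu, ordAt_mul R hhm'0 hgQ.1, hhm',
      Isogeny.ordAt_pullbackHom_zsmul hmZ hmK, hordh', hgQ.ordAt_eq, map_zsmul, ← he]
    simp only [eq_comm (a := Qh), eq_comm (a := (0 : W.geomPoints))]
    ring
  obtain ⟨κ, hκ0, hgκ⟩ := exists_eq_smul_of_ordAt_eq hφg0 hu0 hord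
  -- apply `τ_S`
  have hlhs : W.transAlgHom S (φ.pullbackHom gT) =
      weilPairingFun hm (φ S) T • φ.pullbackHom gT := by
    rw [φ.transAlgHom_pullbackHom, transAlgHom_weilFn hm hφS hP, map_mul, AlgHom.commutes,
      Algebra.smul_def]
  have hτu : W.transAlgHom S u = weilPairingFun hm S Qh • u := by
    rw [hu, map_mul, hhm', transAlgHom_pullbackHom_zsmul hmZ, hS, transAlgHom_zero,
      AlgHom.id_apply, transAlgHom_weilFn hm hS hQh0, Algebra.smul_def, mul_left_comm]
  have hrhs : W.transAlgHom S (φ.pullbackHom gT) = weilPairingFun hm S Qh • φ.pullbackHom gT := by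
    conv_lhs => rw [hgκ]
    rw [map_smul, hτu, smul_comm, ← hgκ]
  rw [hrhs] at hlhs
  exact (smul_left_injective _ hφg0 hlhs).symm

end Adjoint

/-! ## The discharge -/

section Discharge

variable (W)

/-- **Prop. III.8.1 (a)–(d) and Prop. III.8.2 (with Thm. III.6.1(b)) hold for one and the same
pairing: the named fact `exists_weilPairing_adjoint W m` is discharged** by the Weil pairing
`weilPairingFun` of `WeilPairingProofs` — (a)–(d) are that file's `weilPairingFun_pow`,
`weilPairingFun_add_left`, `weilPairingFun_add_right`, `weilPairingFun_self`,
`eq_zero_of_weilPairingFun_eq_one`, `weilPairingFun_smul`, and III.8.2 is `weilPairingFun_isogeny`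
above. [cite: SilvermanAEC2009, Prop. III.8.1 (a)–(d), Prop. III.8.2, Thm. III.6.1(b)] -/
theorem exists_weilPairing_adjoint_holds (m : ℕ) : W.exists_weilPairing_adjoint m := by
  intro _ _ hmK
  -- `S ∈ E[n] ↔ n • S = O` (`Submodule.mem_torsionBy_iff`; the tree's `KummerMap.mem_geomTorsion_iff`)
  have mem_iff : ∀ {n : ℤ} {S : W.geomPoints}, S ∈ geomTorsion W n ↔ n • S = 0 := Iff.rfl
  simp only [mem_iff]
  exact ⟨weilPairingFun hmK, fun S hS T hT ↦ weilPairingFun_pow hmK hS hT,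
    fun S₁ hS₁ S₂ hS₂ T hT ↦ weilPairingFun_add_left hmK hS₁ hS₂ hT,
    fun S hS T₁ hT₁ T₂ hT₂ ↦ weilPairingFun_add_right hmK hS hT₁ hT₂,
    fun T hT ↦ weilPairingFun_self hmK hT,
    fun T hT h ↦ eq_zero_of_weilPairingFun_eq_one hmK hT h,
    fun σ S hS T hT ↦ weilPairingFun_smul hmK σ hS hT,
    fun φ S hS P hP ↦ weilPairingFun_isogeny hmK φ hS hP⟩

end Discharge

end WeierstrassCurve
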